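import Summits.NavierStokesRegularity.NavierStokesRegularity.Theses.QuantisedSymmetry
import Summits.NavierStokesRegularity.NavierStokesRegularity.Theses.Blowup
import Summits.NavierStokesRegularity.NavierStokesRegularity.Theorems.QuantisedSymmetryPolyhedralDssProfileExistsCellOfProfile
import Summits.NavierStokesRegularity.NavierStokesRegularity.Theorems.QuantisedSymmetryPolyhedralDssProfileExistsDominatesBlowupProfile
import Summits.NavierStokesRegularity.NavierStokesRegularity.Theorems.QuantisedSymmetryPolyhedralTruncationBridge
import HarnessLib

/-!
# Strategist census sketch `s14-g13` — crux `PolyhedralDssProfileExists` (stmt-NavierStokesRegularity-1404)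

Companion to `STRATEGY-CENSUS-s14.md` (independent census, family `-s`, gen 13). Every declaration
below is checked (`lean check` rc 0, no `sorry`). It records, as Lean signatures over existing
declarations, the attempts of the census:

* `## Weaker intermediate`: the crux implies the sector-free ∃-crux `Blowup.BlowupTypeIDssProfile`
  (stmt-0155) and — by LANDED theorems only — decides the summit negatively (`crux_alone_decides`), so
  every intermediate that still feeds `closes` sits on the chain crux ⇒ 0155 ⇒ finite-lifespan
  Leray–Hopf classical solution ⇒ ¬S.
* `## Decomposition`: the best typed conjunction split I could produce — `ApproxCellSequence`
  (near-cells with junction defect → 0, uniform bounds, pinned amplitude) ∧ `ApproxCellCompactness`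
  (limits of such families are genuine cells) ⇒ crux (`crux_of_subs`, proved); but the crux implies
  the first piece by constant families (`approxCellSequence_of_crux`, proved), so modulo the soft
  second piece the first piece IS the crux: no leverage.
* `## Strengthen`: two rigidifications typed (`SelfSimilarPolyhedralProfileExists` — refuted in print,
  NRŠ 1996 / Tsai 1998 = `Literature.Analysis.FluidPDE.tsai_selfsimilar_holds`; and the aligned /
  Beltrami ansatz `AlignedPolyhedralProfileExists` — caloric, hence Liouville-trivial), each with its
  trivial implication to the crux.
-/

set_option linter.dupNamespace false
set_option autoImplicit false

namespace Summit.NavierStokesRegularity.NavierStokesRegularity.Cruxes.PolyhedralDssProfileExists.StrategistS14g13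

open MeasureTheory Set Function Filter Topology
open Literature.Analysis.FluidPDE
open Summit.NavierStokesRegularity.NavierStokesRegularity.Theorems.PolyhedralDssProfileExists.PolyhedralCell

/-- Physical space `ℝ³`. -/
abbrev E3 : Type := EuclideanSpace ℝ (Fin 3)

/-- The group clause of the crux: `G` finite, proper rotations, acting irreducibly on `ℝ³`. -/
def IsPolyhedralGroup (G : Subgroup (E3 ≃ₗᵢ[ℝ] E3)) : Prop :=
  Finite G ∧ (∀ g ∈ G, LinearMap.det (g.toLinearEquiv : E3 →ₗ[ℝ] E3) = 1) ∧
    (∀ V : Submodule ℝ E3, (∀ g ∈ G, ∀ v ∈ V, g v ∈ V) → V = ⊥ ∨ V = ⊤)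

/-! ## Weaker intermediate (from the summit statement down) -/

/-- W1. The crux implies the SECTOR-FREE ∃-crux of routes `Blowup` / `DssFarFieldSlaving`
(stmt-NavierStokesRegularity-0155): landed `stub_dominatesBlowupProfile`. -/
theorem weaker_blowupProfile :
    _root_.Summit.NavierStokesRegularity.NavierStokesRegularity.Theses.QuantisedSymmetry.PolyhedralDssProfileExists →
      _root_.Summit.NavierStokesRegularity.NavierStokesRegularity.Theses.Blowup.BlowupTypeIDssProfile :=
  stub_dominatesBlowupProfile

/-- W0. The crux ALONE decides the summit (negatively) by landed theorems: the truncation bridge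
(`quantisedSymmetry_polyhedralTruncationBridge_proof`) and weak–strong uniqueness
(`ClayUniqueness_holds`) are proved, so `closes` consumes only the crux. -/
theorem crux_alone_decides :
    _root_.Summit.NavierStokesRegularity.NavierStokesRegularity.Theses.QuantisedSymmetry.PolyhedralDssProfileExists →
      ¬ _root_.NavierStokesRegularity :=
  fun hX =>
    _root_.Summit.NavierStokesRegularity.NavierStokesRegularity.Theses.QuantisedSymmetry.closes hX
      _root_.Summit.NavierStokesRegularity.NavierStokesRegularity.Theorems.quantisedSymmetry_polyhedralTruncationBridge_proof
      _root_.Summit.NavierStokesRegularity.NavierStokesRegularity.Theses.QuantisedSymmetry.ClayUniqueness_holds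

/-! ## Decomposition (typed conjunction split; assembly proved; which piece is the crux) -/

/-- An `ε`-approximate polyhedral cell with group `G` and factor `c`: the landed cell clauses
(`polyhedralDssProfileExists_iff_cell`) with the exact zoom junction `v(-c⁻², x) = c v(-1, cx)`
relaxed to a uniform defect `≤ ε`. -/
def IsApproxCell (G : Subgroup (E3 ≃ₗᵢ[ℝ] E3)) (c ε : ℝ) (v : ℝ → E3 → E3) : Prop :=
  ContinuousOn (Function.uncurry v) (Set.Icc (-1 : ℝ) (-(c ^ 2)⁻¹) ×ˢ Set.univ) ∧
    (∃ M : ℝ, ∀ t ∈ Set.Icc (-1 : ℝ) (-(c ^ 2)⁻¹), ∀ x, ‖v t x‖ ≤ M) ∧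
    (∀ t ∈ Set.Icc (-1 : ℝ) (-(c ^ 2)⁻¹), IsWeaklyDivFree (v t)) ∧
    (∀ s t : ℝ, -1 ≤ s → s < t → t ≤ -(c ^ 2)⁻¹ → ∀ x,
      v t x = heatFlow (v s) (t - s) x - oseenDuhamel 1 s v v t x) ∧
    (∀ x, ‖v (-(c ^ 2)⁻¹) x - c • v (-1) (c • x)‖ ≤ ε) ∧
    (∀ g ∈ G, ∀ t ∈ Set.Icc (-1 : ℝ) (-(c ^ 2)⁻¹), ∀ x, v t (g x) = g (v t x))

/-- A genuine polyhedral cell (verbatim the clause of `polyhedralDssProfileExists_iff_cell`). -/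
def IsCell (G : Subgroup (E3 ≃ₗᵢ[ℝ] E3)) (c : ℝ) (v : ℝ → E3 → E3) : Prop :=
  ContinuousOn (Function.uncurry v) (Set.Icc (-1 : ℝ) (-(c ^ 2)⁻¹) ×ˢ Set.univ) ∧
    (∃ M : ℝ, ∀ t ∈ Set.Icc (-1 : ℝ) (-(c ^ 2)⁻¹), ∀ x, ‖v t x‖ ≤ M) ∧
    (∀ t ∈ Set.Icc (-1 : ℝ) (-(c ^ 2)⁻¹), IsWeaklyDivFree (v t)) ∧
    (∀ s t : ℝ, -1 ≤ s → s < t → t ≤ -(c ^ 2)⁻¹ → ∀ x,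
      v t x = heatFlow (v s) (t - s) x - oseenDuhamel 1 s v v t x) ∧
    (∀ x, v (-(c ^ 2)⁻¹) x = c • v (-1) (c • x)) ∧
    (∀ g ∈ G, ∀ t ∈ Set.Icc (-1 : ℝ) (-(c ^ 2)⁻¹), ∀ x, v t (g x) = g (v t x))

/-- The uniform side conditions of an approximating family: common sup bound `M`, common `L⁴` bound
`M` at `t = -1`, and a pinned amplitude `δ ≤ |v(-1, x₀)|` (rules out collapse to the trivial cell). -/
def UniformlyControlled (c M : ℝ) (x₀ : E3) (δ : ℝ) (v : ℝ → E3 → E3) : Prop :=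
  (∀ t ∈ Set.Icc (-1 : ℝ) (-(c ^ 2)⁻¹), ∀ x, ‖v t x‖ ≤ M) ∧
    MemLp (v (-1)) 4 volume ∧ eLpNorm (v (-1)) 4 volume ≤ ENNReal.ofReal M ∧ δ ≤ ‖v (-1) x₀‖

/-- Sub₁ (`ApproxCellSequence`): for some admissible `(G, c)` there are `ε`-approximate cells for
every `ε > 0`, uniformly controlled and pinned away from zero. -/
def ApproxCellSequence : Prop :=
  ∃ G : Subgroup (E3 ≃ₗᵢ[ℝ] E3), IsPolyhedralGroup G ∧ ∃ c : ℝ, 1 < c ∧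
    ∃ M : ℝ, ∃ x₀ : E3, ∃ δ : ℝ, 0 < δ ∧
      ∀ ε : ℝ, 0 < ε → ∃ v : ℝ → E3 → E3, IsApproxCell G c ε v ∧ UniformlyControlled c M x₀ δ v

/-- Sub₂ (`ApproxCellCompactness`): a uniformly controlled, pinned family of `ε`-approximate cells
(`ε → 0`) yields a genuine cell with nontrivial `L⁴` datum (parabolic smoothing on `(-1, -c⁻²]`,
the junction transporting equicontinuity back to `t = -1`, dominated convergence in the Oseen
formula, Fatou for `L⁴`, pointwise limit at `x₀`). Soft; L-sized in Lean. -/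
def ApproxCellCompactness : Prop :=
  ∀ G : Subgroup (E3 ≃ₗᵢ[ℝ] E3), IsPolyhedralGroup G → ∀ c : ℝ, 1 < c →
    ∀ (M : ℝ) (x₀ : E3) (δ : ℝ), 0 < δ →
      (∀ ε : ℝ, 0 < ε → ∃ v : ℝ → E3 → E3, IsApproxCell G c ε v ∧ UniformlyControlled c M x₀ δ v) →
        ∃ v : ℝ → E3 → E3, IsCell G c v ∧ MemLp (v (-1)) 4 volume ∧ ¬ (v (-1) =ᵐ[volume] 0)

/-- ASSEMBLY (proved): Sub₁ → Sub₂ → crux, through the landed `cell ⇒ profile` direction of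
`polyhedralDssProfileExists_iff_cell` (`stub_profileOfPolyhedralCell`, p152884). -/
theorem crux_of_subs (h₁ : ApproxCellSequence) (h₂ : ApproxCellCompactness) :
    _root_.Summit.NavierStokesRegularity.NavierStokesRegularity.Theses.QuantisedSymmetry.PolyhedralDssProfileExists := by
  obtain ⟨G, hG, c, hc, M, x₀, δ, hδ, hfam⟩ := h₁
  obtain ⟨v, hcell, hL4, hnt⟩ := h₂ G hG c hc M x₀ δ hδ hfam
  obtain ⟨hcont, hbd, hdiv, hmild, hjunc, heqv⟩ := hcell
  exact polyhedralDssProfileExists_iff_cell.mpr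
    ⟨G, hG.1, hG.2.1, hG.2.2, c, hc, v, ⟨hcont, hbd, hdiv, hmild, hjunc, heqv⟩, hL4, hnt⟩

/-- WHY THE SPLIT HAS NO TEETH (proved): the crux implies Sub₁ by CONSTANT families (a genuine cell is
an `ε`-approximate cell for every `ε`), via the landed `profile ⇒ cell` direction
(`stub_cellOfProfile`). Hence Sub₁ ⟺ crux modulo the soft Sub₂: the hard piece is the crux reworded. -/
theorem approxCellSequence_of_crux
    (h : _root_.Summit.NavierStokesRegularity.NavierStokesRegularity.Theses.QuantisedSymmetry.PolyhedralDssProfileExists) :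
    ApproxCellSequence := by
  obtain ⟨G, hfin, hdet, hirr, c, hc, v, hcell, hL4, hnt⟩ := polyhedralDssProfileExists_iff_cell.mp h
  obtain ⟨hcont, ⟨M₀, hM₀⟩, hdiv, hmild, hjunc, heqv⟩ := hcell
  have hx : ∃ x₀, v (-1) x₀ ≠ 0 := by
    by_contra hcon
    push Not at hcon
    exact hnt (ae_of_all _ hcon)
  obtain ⟨x₀, hx₀⟩ := hx
  have htop : eLpNorm (v (-1)) 4 volume ≠ ⊤ := hL4.eLpNorm_ne_top
  refine ⟨G, ⟨hfin, hdet, hirr⟩, c, hc, max M₀ (eLpNorm (v (-1)) 4 volume).toReal, x₀, ‖v (-1) x₀‖,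
    norm_pos_iff.mpr hx₀, fun ε hε => ⟨v, ?_, ?_, hL4, ?_, le_rfl⟩⟩
  · refine ⟨hcont, ⟨M₀, hM₀⟩, hdiv, hmild, fun x => ?_, heqv⟩
    rw [hjunc x, sub_self, norm_zero]
    exact hε.le
  · exact fun t ht x => (hM₀ t ht x).trans (le_max_left _ _)
  · calc eLpNorm (v (-1)) 4 volume
        = ENNReal.ofReal (eLpNorm (v (-1)) 4 volume).toReal := (ENNReal.ofReal_toReal htop).symm
      _ ≤ ENNReal.ofReal (max M₀ (eLpNorm (v (-1)) 4 volume).toReal) :=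
          ENNReal.ofReal_le_ofReal (le_max_right _ _)

/-! ## Strengthen (rigidifications typed; each trivially implies the crux) -/

/-- S⁺₁: the `c`-free (continuously self-similar) rigidification. REFUTED in print: a Type-I
self-similar ancient mild profile is a bounded smooth Leray profile with `|U| ≲ (1+|y|)⁻¹`, hence in
`L^q`, `3 < q < ∞`, hence zero (Tsai 1998 Thm 1 = `tsai_selfsimilar_holds`; NRŠ 1996). Recorded only
to show the rigid end of the ladder is dead, so there is no parameter to induct on from it. -/
def SelfSimilarPolyhedralProfileExists : Prop :=
  ∃ G : Subgroup (E3 ≃ₗᵢ[ℝ] E3), IsPolyhedralGroup G ∧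
    ∃ u : ℝ → E3 → E3, IsAncientMildSolution 1 u ∧ (∀ t < 0, AEStronglyMeasurable (u t) volume) ∧
      IsSelfSimilar u ∧ (∃ C₀ : ℝ, HasTypeIDecay C₀ u) ∧ (∀ g ∈ G, ∀ t x, u t (g x) = g (u t x)) ∧
      ¬ (∀ t < 0, u t =ᵐ[volume] 0)

theorem crux_of_selfSimilar (h : SelfSimilarPolyhedralProfileExists) :
    _root_.Summit.NavierStokesRegularity.NavierStokesRegularity.Theses.QuantisedSymmetry.PolyhedralDssProfileExists := by
  obtain ⟨G, ⟨hfin, hdet, hirr⟩, u, hanc, hmeas, hss, hdec, heqv, hnt⟩ := h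
  exact ⟨G, hfin, hdet, hirr, 2, by norm_num, u, hanc, hmeas,
    hss.isDiscretelySelfSimilar (by norm_num : (0 : ℝ) < 2), hdec, heqv, hnt⟩

/-- S⁺₂: the aligned (generalised-Beltrami) ansatz `curl u ∥ u` slice-wise. The Lamb vector
`ω × u` then vanishes, the profile solves the HEAT equation with a gradient pressure, and the Type-I
ancient caloric Liouville theorem makes it zero — a Liouville-killed class like 2D, shear, radial and
axisymmetric-no-swirl (KNSS 2009 Thms 5.1–5.3). Typed to record that closed-form ansätze live in
killed classes. -/
def AlignedPolyhedralProfileExists : Prop :=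
  ∃ G : Subgroup (E3 ≃ₗᵢ[ℝ] E3), IsPolyhedralGroup G ∧ ∃ c : ℝ, 1 < c ∧
    ∃ u : ℝ → E3 → E3, IsAncientMildSolution 1 u ∧ (∀ t < 0, AEStronglyMeasurable (u t) volume) ∧
      IsDiscretelySelfSimilar c u ∧ (∃ C₀ : ℝ, HasTypeIDecay C₀ u) ∧
      (∀ g ∈ G, ∀ t x, u t (g x) = g (u t x)) ∧ ¬ (∀ t < 0, u t =ᵐ[volume] 0) ∧
      (∀ t < 0, ∀ x, ∃ κ : ℝ, curl (u t) x = κ • u t x)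

theorem crux_of_aligned (h : AlignedPolyhedralProfileExists) :
    _root_.Summit.NavierStokesRegularity.NavierStokesRegularity.Theses.QuantisedSymmetry.PolyhedralDssProfileExists := by
  obtain ⟨G, ⟨hfin, hdet, hirr⟩, c, hc, u, hanc, hmeas, hdss, hdec, heqv, hnt, -⟩ := h
  exact ⟨G, hfin, hdet, hirr, c, hc, u, hanc, hmeas, hdss, hdec, heqv, hnt⟩

end Summit.NavierStokesRegularity.NavierStokesRegularity.Cruxes.PolyhedralDssProfileExists.StrategistS14g13
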